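import Summits.QuantumFields.YangMills.Theorems.UnitScaleTiltHalvingP1FlatCoreAxialFrames
import Literature.MathematicalPhysics.QuantumFieldTheory.Balaban1983to89.BlockAveragingPlaquetteBound
import HarnessLib

/-!
# `UnitScaleTiltHalvingP1FlatCoreFrameLinRelative` — line H (`BirthV10.stub_halvingStep`, stmt-QuantumFields-19200), T2♭-PLAN v1.1 #46 §3 J4, the k-fold INDUCTION in
# LOG-RELATIVE CURRENCY, FILE 1: THE EFFECTIVE-GAUGE STEP IS «LEFT-TRANSLATE BY THE CENTRE VALUE, NONLINEAR MEAN OF THE RELATIVE FACTORS» — EXACTLY, WITH NO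
# BCH REMAINDER — and its one-level sizes

WHY (cell `ym3-torus`, LEAD-H ★w5-19200 g4; this seat's DESIGN line 2026-08-28T11:29Z).  Down a block-axial pre-gauge (J3 (3), ✓`P1FlatCoreAxialFrames.effGauge_step_of_stairs`:
`κ_{j+1}(y) = v(Ū^{(j)}{}^{κ_j})(y)⁻¹ · κ_j(ȳ)`, centre stairs of `X := emlIterU j W₁` trivial) the frame of the gauge copy is `v(X^{κ})(y) = eml_i (κ(ȳ)·1·κ(x_i)⁻¹)`
(✓`coe_vframeU`, ✓`holT_gaugeActT`), and `κ(ȳ)κ(x_i)⁻¹ = g · r_i⁻¹ · g⁻¹` with `g := κ(ȳ)`, `r_i := g⁻¹κ(x_i)` the RELATIVE factors over the centre stairs; since `eml` commutes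
with conjugation (✓`ExpMeanLog.eml_conj`, [Balaban1987RG1] (0.6)) and inverts pointwise inverses ((0.5), ✓`eml_mul_inv`), THIS FILE proves
★★ `effGauge_step_eq_mul_eml_rel`: **`κ_{j+1}(y) = κ_j(ȳ) · eml_i (κ_j(ȳ)⁻¹ κ_j(x_i))`** — the step is W-FREE, has NO Baker–Campbell–Hausdorff remainder, and every
quantity in it except the centre value is a RELATIVE factor `O(osc)`; this is the identity behind the k-uniform (log-relative) induction for the top restriction (o)'s remainder
`Ctop` (rows (T121)∕(T125)), where the absolute-log form `l_{j+1} = bchLog(l_j(ȳ), mean_i bchLog(−l_j(ȳ), l_j(x_i)))` loses k-uniformity through the sup size of `l_j`.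
§2 gives the one-level sizes in that currency: `‖eml r − 1‖ ≤ 6m` and `‖mlog (eml r)‖ ≤ …` for `‖r_i − 1‖ ≤ m ≤ ½` (✓`norm_eml_sub_one_le_six_mul`), hence
★ `norm_centreRel_step_le`: `‖κ_j(ȳ)⁻¹ κ_{j+1}(y) − 1‖ ≤ 6·max_i ‖κ_j(ȳ)⁻¹κ_j(x_i) − 1‖` — the next level's value stays within the block's relative oscillation of this level's.
HONEST FRAMING.  Exact algebra + one crude size; nothing of [B8] Sect. D–E or of the tower induction's k-uniform bookkeeping (FILE 2) is proved here; count-neutral helper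
(`--supports stmt-QuantumFields-19200 --as helper`, ★★OWNER ACK 45); registry untouched.  YM₃ on T³ = rung R3, NOT the Clay problem; nothing here proves `core′`, the stub,
the crux or a mass gap.

References: T. Bałaban, Commun. Math. Phys. 98 (1985) 17–51 [Balaban1985Averaging] ((89) p.31, (97)–(100) p.32, (110) p.34); Commun. Math. Phys. 109 (1987) 249–301
[Balaban1987RG1] ((0.4)–(0.7) p.253); Commun. Math. Phys. 99 (1985) 75–102 [Balaban1985RegularSpaces] (Sect. E p.95, (1.121)∕(1.125) pp.96–97).
-/

set_option autoImplicit false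

noncomputable section

namespace Summit.QuantumFields.YangMills.Theorems.P1FlatCoreFrameLinRelative

open NormedSpace
open Literature.MathematicalPhysics.QuantumFieldTheory.Balaban1983to89
open T4Continuum BlockAveraging ExpMeanLog MatrixLog
open B10Eq27TorusAxialLog (holT gaugeActT gaugeActT_apply)
open Summit.QuantumFields.YangMills.Theorems.Prop8Chart (holT_gaugeActT)
open Summit.QuantumFields.YangMills.Theorems.Prop8ChartDoubleBar (vframeU coe_vframeU)
open BlockAveragingPlaquetteBound (norm_eml_sub_one_le_six_mul)

variable {P : Params} {𝔸 : Type*} [NormedRing 𝔸] [NormedAlgebra ℂ 𝔸] [CompleteSpace 𝔸]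

/-! ## §1 The exact step in relative form -/

section Step

variable {j : ℕ}

/-- **THE FRAME OF A GAUGE COPY OF A BLOCK-AXIAL FIELD IS THE CONJUGATED `eml` OF THE INVERSE RELATIVE FACTORS**: with trivial centre stairs of `X` in the block of `y`,
`v(X^{κ})(y) = κ(ȳ) · eml_i ((κ(ȳ)⁻¹κ(x_i))⁻¹) · κ(ȳ)⁻¹`. [cite: Balaban1985Averaging, (110) p.34, (8)-(9) p.19; Balaban1987RG1, (0.6) p.253] -/
theorem coe_vframeU_gaugeActT_of_stairs (X : GaugeField P j 𝔸ˣ) (κ : GaugeTransf P j 𝔸ˣ) (y : Site P (j + 1))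
    (hax : ∀ i : Idx P, holT X (emb y) (stairWord i.2.1 (off i.1)) = 1) :
    ((vframeU (gaugeActT κ X) y : 𝔸ˣ) : 𝔸) =
      (κ (emb y) : 𝔸) * eml (fun i : Idx P => ((((κ (emb y))⁻¹ * κ (walkEnd (emb y) (stairWord i.2.1 (off i.1))))⁻¹ : 𝔸ˣ) : 𝔸)) *
        ((κ (emb y))⁻¹ : 𝔸ˣ) := by
  rw [coe_vframeU]
  have hfam : (fun i : Idx P => ((holT (gaugeActT κ X) (emb y) (stairWord i.2.1 (off i.1)) : 𝔸ˣ) : 𝔸)) =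
      fun i : Idx P => (κ (emb y) : 𝔸) * ((((κ (emb y))⁻¹ * κ (walkEnd (emb y) (stairWord i.2.1 (off i.1))))⁻¹ : 𝔸ˣ) : 𝔸) *
        ((κ (emb y))⁻¹ : 𝔸ˣ) := by
    funext i
    rw [holT_gaugeActT, hax i, mul_one, mul_inv_rev, inv_inv, Units.val_mul, Units.val_mul]
    rw [mul_assoc (κ (emb y) : 𝔸), mul_assoc (((κ (walkEnd (emb y) (stairWord i.2.1 (off i.1))))⁻¹ : 𝔸ˣ) : 𝔸), Units.mul_inv, mul_one]
  rw [hfam, eml_conj (Units.mul_inv _) (Units.inv_mul _)]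

/-- **★★ THE EFFECTIVE-GAUGE STEP IN RELATIVE FORM — EXACT**: if `κ′ = v(X^{κ})(y)⁻¹·κ(ȳ)` (the block-axial recursion of
`P1FlatCoreAxialFrames.effGauge_step_of_stairs`), the centre stairs of `X` in the block of `y` are trivial and the relative factors are within `1∕3` of `1`, then
`κ′ = κ(ȳ) · eml_i (κ(ȳ)⁻¹ κ(x_i))` — left translation by the centre value of the nonlinear mean of the RELATIVE factors; no field, no BCH remainder.
[cite: Balaban1985Averaging, (97)-(100) p.32, (110) p.34; Balaban1987RG1, (0.5)-(0.6) p.253] -/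
theorem effGauge_step_eq_mul_eml_rel (X : GaugeField P j 𝔸ˣ) (κ : GaugeTransf P j 𝔸ˣ) (y : Site P (j + 1)) (κ' : 𝔸ˣ)
    (hs : κ' = (vframeU (gaugeActT κ X) y)⁻¹ * κ (emb y))
    (hax : ∀ i : Idx P, holT X (emb y) (stairWord i.2.1 (off i.1)) = 1)
    (hrel : ∀ i : Idx P, ‖((((κ (emb y))⁻¹ * κ (walkEnd (emb y) (stairWord i.2.1 (off i.1))) : 𝔸ˣ) : 𝔸)) - 1‖ ≤ 1 / 3) :
    (κ' : 𝔸) = (κ (emb y) : 𝔸) * eml (fun i : Idx P => (((κ (emb y))⁻¹ * κ (walkEnd (emb y) (stairWord i.2.1 (off i.1))) : 𝔸ˣ) : 𝔸)) := by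
  set g : 𝔸ˣ := κ (emb y) with hg
  set r : Idx P → 𝔸ˣ := fun i => (κ (emb y))⁻¹ * κ (walkEnd (emb y) (stairWord i.2.1 (off i.1))) with hr
  -- `eml r · eml r⁻¹ = 1`, so `eml r⁻¹ = (eml r)⁻¹` as units
  have hinv : eml (fun i => ((r i : 𝔸ˣ) : 𝔸)) * eml (fun i => (((r i)⁻¹ : 𝔸ˣ) : 𝔸)) = 1 :=
    eml_mul_inv (fun i => Units.mul_inv _) hrel
  have hinv' : eml (fun i => (((r i)⁻¹ : 𝔸ˣ) : 𝔸)) * eml (fun i => ((r i : 𝔸ˣ) : 𝔸)) = 1 :=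
    eml_inv_mul (fun i => Units.mul_inv _) hrel
  -- the frame, as a unit, is `g · E⁻¹ · g⁻¹` with `E := eml r`
  have hv : ((vframeU (gaugeActT κ X) y : 𝔸ˣ) : 𝔸) = (g : 𝔸) * eml (fun i => (((r i)⁻¹ : 𝔸ˣ) : 𝔸)) * ((g⁻¹ : 𝔸ˣ) : 𝔸) :=
    coe_vframeU_gaugeActT_of_stairs X κ y hax
  -- invert: `v⁻¹ = g · E · g⁻¹`
  have hvinv : (((vframeU (gaugeActT κ X) y)⁻¹ : 𝔸ˣ) : 𝔸) = (g : 𝔸) * eml (fun i => ((r i : 𝔸ˣ) : 𝔸)) * ((g⁻¹ : 𝔸ˣ) : 𝔸) := by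
    apply Units.inv_eq_of_mul_eq_one_left
    rw [hv]
    calc (g : 𝔸) * eml (fun i => ((r i : 𝔸ˣ) : 𝔸)) * ((g⁻¹ : 𝔸ˣ) : 𝔸) * ((g : 𝔸) * eml (fun i => (((r i)⁻¹ : 𝔸ˣ) : 𝔸)) * ((g⁻¹ : 𝔸ˣ) : 𝔸))
        = (g : 𝔸) * (eml (fun i => ((r i : 𝔸ˣ) : 𝔸)) * ((((g⁻¹ : 𝔸ˣ) : 𝔸) * (g : 𝔸)) * eml (fun i => (((r i)⁻¹ : 𝔸ˣ) : 𝔸)))) *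
            ((g⁻¹ : 𝔸ˣ) : 𝔸) := by noncomm_ring
      _ = 1 := by rw [Units.inv_mul, one_mul, hinv, mul_one, Units.mul_inv]
  rw [hs, Units.val_mul, hvinv]
  calc (g : 𝔸) * eml (fun i => ((r i : 𝔸ˣ) : 𝔸)) * ((g⁻¹ : 𝔸ˣ) : 𝔸) * (κ (emb y) : 𝔸)
      = (g : 𝔸) * eml (fun i => ((r i : 𝔸ˣ) : 𝔸)) * (((g⁻¹ : 𝔸ˣ) : 𝔸) * (g : 𝔸)) := by rw [hg]; noncomm_ring
    _ = (g : 𝔸) * eml (fun i => ((r i : 𝔸ˣ) : 𝔸)) := by rw [Units.inv_mul, mul_one]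

end Step

/-! ## §2 One-level sizes in the relative currency -/

section Sizes

variable {ι : Type*} [Fintype ι] [Nonempty ι]

/-- **THE NONLINEAR MEAN OF NEAR-IDENTITY FACTORS IS NEAR THE IDENTITY**: `‖r_i − 1‖ ≤ m ≤ ½ ⇒ ‖eml r − 1‖ ≤ 6m` (✓`norm_eml_sub_one_le_six_mul`, restated in the
letters of the relative step). [cite: Balaban1987RG1, (0.4) p.253; Balaban1985Averaging, Prop. 1 (51) p.26] -/
theorem norm_eml_rel_sub_one_le (r : ι → 𝔸) {m : ℝ} (hr : ∀ i, ‖r i - 1‖ ≤ m) (hm : m ≤ 1 / 2) : ‖eml r - 1‖ ≤ 6 * m :=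
  norm_eml_sub_one_le_six_mul hr hm

/-- **★ THE NEXT LEVEL'S VALUE STAYS WITHIN THE BLOCK'S RELATIVE OSCILLATION**: for the relative step `κ′ = g · eml r` (`g` the centre value, `r` the relative factors,
`‖r_i − 1‖ ≤ m ≤ ½`), `‖g⁻¹κ′ − 1‖ ≤ 6m` — so the relative factor between a coarse site and the centre of its block is `O(osc)` and NO size of `g` enters.
[cite: Balaban1985Averaging, (110) p.34; Balaban1987RG1, (0.4)-(0.6) p.253] -/
theorem norm_centreRel_step_le (g κ' : 𝔸ˣ) (r : ι → 𝔸) (hκ' : (κ' : 𝔸) = (g : 𝔸) * eml r) {m : ℝ} (hr : ∀ i, ‖r i - 1‖ ≤ m) (hm : m ≤ 1 / 2) :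
    ‖(((g⁻¹ * κ') : 𝔸ˣ) : 𝔸) - 1‖ ≤ 6 * m := by
  have h : (((g⁻¹ * κ') : 𝔸ˣ) : 𝔸) = eml r := by
    rw [Units.val_mul, hκ', ← mul_assoc, Units.inv_mul, one_mul]
  rw [h]
  exact norm_eml_rel_sub_one_le r hr hm

/-- **THE LOG OF THE NEXT LEVEL'S RELATIVE VALUE IS THE MEAN OF THE LOGS OF THE RELATIVE FACTORS** (no remainder): `mlog (g⁻¹κ′) = |I|⁻¹ Σ_i mlog r_i` when
`‖r_i − 1‖ ≤ 1∕12` (so that the mean of the logs is in the injectivity ball of `exp`). [cite: Balaban1987RG1, (0.4) p.253] -/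
theorem mlog_centreRel_step_eq (g κ' : 𝔸ˣ) (r : ι → 𝔸) (hκ' : (κ' : 𝔸) = (g : 𝔸) * eml r) (hr : ∀ i, ‖r i - 1‖ ≤ 1 / 12) :
    mlog ((((g⁻¹ * κ') : 𝔸ˣ) : 𝔸)) = ((Fintype.card ι : ℂ))⁻¹ • ∑ i, mlog (r i) := by
  have h : (((g⁻¹ * κ') : 𝔸ˣ) : 𝔸) = eml r := by
    rw [Units.val_mul, hκ', ← mul_assoc, Units.inv_mul, one_mul]
  rw [h, eml_eq_exp]
  apply B7Eq170Flat.mlog_exp_of_le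
  -- `‖mean mlog r‖ ≤ max ‖mlog r_i‖ ≤ 2·(1/12) ≤ 1/5`
  have hi : ∀ i, ‖mlog (r i)‖ < 1 / 5 := fun i =>
    lt_of_le_of_lt (norm_mlog_le_two_mul ((hr i).trans (by norm_num))) (by linarith [hr i])
  exact (norm_meanLog_lt hi).le

end Sizes

end Summit.QuantumFields.YangMills.Theorems.P1FlatCoreFrameLinRelative

end
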